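import Summits.AtomisticToContinuum.Crystallization.Theorems.PhononSlackCertificatesPeriodicGivenLayeredExtraction2

/-!
# `PeriodicGivenLayered` (stmt-AtomisticToContinuum-11779), line `Sketch` — extraction, part 3:
# one layered set in the hull (the compactness argument)

Support file for the stub `stub_extraction` of the line `Sketch` of `PeriodicGivenLayered`
(parts 1–2: `…PeriodicGivenLayeredExtraction1/2`). `ext_extraction` is the stub's statement verbatim
(with `EuclideanSpace ℝ (Fin 3)` spelled out): if, for every radius `R` and tolerance `ε > 0`,
frequently in `N`, some translate of `x N` is two-way `ε`-matched on `‖·‖ ≤ R` with SOME layered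
set `{A (i u(a) + j v(a) + L_s(m) w(a) + z(m) e₃)}` (rigid motion `A`, Hägg word `s`, heights `z`
with increments in `[39a/50, 17a/20]`, all depending on the window), then ONE layered set (same
`a`) is two-way matched at every scale, frequently in `N`. Pure compactness, no hypothesis on `x`:

1. normalise every window so that `z 0 ∈ [−17a/20, 0]` (re-index the layers; the label shift is a
   bounded translation absorbed by `t`; `ext_normalise`, part 1);
2. along a diagonal sequence of normalised `(k, 1/(k+1))`-windows
   (`Filter.extraction_forall_of_frequently`) the data `(A_k, s_k, z_k)` live in the compact set
   `Isom(ℝ³) × {±1}^ℤ × {normalised heights}` (part 2), hence have a cluster point `(A₀, s₀, z₀)`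
   (`IsCompact.exists_mapClusterPt`);
3. for a target `(R, ε)`, data close to the cluster point in finitely many coordinates give
   layered sets two-way `ε/2`-close to the limit set on `‖·‖ ≤ R + 1` (`ext_close_points`), so a
   fine window with such data is an `(R, ε)`-window for the limit set (`ext_match_perturb`).

No definitions.
-/

noncomputable section

namespace Summit.AtomisticToContinuum.Crystallization.Theorems.LayeredHull

open scoped BigOperators
open Filter Topology Literature.MathematicalPhysics.StatisticalMechanics

/-- **Extraction of one layered set in the hull.** If, for every `R` and `ε > 0`, frequently in
`N`, a translate of `x N` is two-way `ε`-matched on `‖·‖ ≤ R` with SOME layered set (rigid motion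
`A`, Hägg word `s`, heights `z` with increments in `[39a/50, 17a/20]`, all depending on the
window), then ONE layered set `A(S(a, s, z))` is matched at every scale, frequently in `N`
(cluster point of the normalised data along a diagonal sequence of windows, in the compact data
space). No hypothesis on `x`. [folklore] -/
theorem ext_extraction (x : (N : ℕ) → (Fin N → EuclideanSpace ℝ (Fin 3))) (a : ℝ) (ha : 47 / 50 ≤ a)
    (ha1 : a ≤ 1)
    (hW : ∀ R ε : ℝ, 0 < ε → ∃ᶠ N in atTop,
      ∃ (A : EuclideanSpace ℝ (Fin 3) →ₗᵢ[ℝ] EuclideanSpace ℝ (Fin 3))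
        (t : EuclideanSpace ℝ (Fin 3)) (s : ℤ → ℤ) (z : ℤ → ℝ),
      IsHaggSeq s ∧ (∀ m : ℤ, 39 / 50 * a ≤ z (m + 1) - z m ∧ z (m + 1) - z m ≤ 17 / 20 * a) ∧
      let S : Set (EuclideanSpace ℝ (Fin 3)) :=
        {p | ∃ m i j : ℤ, p = A (((i : ℝ) • triangularVec₁ a) + ((j : ℝ) • triangularVec₂ a) +
          ((haggLabel s m : ℝ) • barlowOffset a) + (z m • layerNormal 1))};
      (∀ p ∈ S, ‖p‖ ≤ R → ∃ i : Fin N, dist (x N i + t) p ≤ ε) ∧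
      (∀ i : Fin N, ‖x N i + t‖ ≤ R → ∃ p ∈ S, dist (x N i + t) p ≤ ε)) :
    ∃ (A : EuclideanSpace ℝ (Fin 3) →ₗᵢ[ℝ] EuclideanSpace ℝ (Fin 3)) (s : ℤ → ℤ) (z : ℤ → ℝ),
      IsHaggSeq s ∧ (∀ m : ℤ, 39 / 50 * a ≤ z (m + 1) - z m ∧ z (m + 1) - z m ≤ 17 / 20 * a) ∧
      let S : Set (EuclideanSpace ℝ (Fin 3)) :=
        {p | ∃ m i j : ℤ, p = A (((i : ℝ) • triangularVec₁ a) + ((j : ℝ) • triangularVec₂ a) +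
          ((haggLabel s m : ℝ) • barlowOffset a) + (z m • layerNormal 1))};
      ∀ R ε : ℝ, 0 < ε → ∃ᶠ N in atTop, ∃ t : EuclideanSpace ℝ (Fin 3),
        (∀ p ∈ S, ‖p‖ ≤ R → ∃ i : Fin N, dist (x N i + t) p ≤ ε) ∧
        (∀ i : Fin N, ‖x N i + t‖ ≤ R → ∃ p ∈ S, dist (x N i + t) p ≤ ε) := by
  have ha0 : 0 < a := by linarith
  -- Step 1: normalised windows at scale `(k, 1/(k+1))`, frequently in `N`, along a diagonal
  -- sequence
  have h1 : ∀ k : ℕ, ∃ᶠ N in atTop, ∃ (A : EuclideanSpace ℝ (Fin 3) →ₗᵢ[ℝ] EuclideanSpace ℝ (Fin 3))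
      (t : EuclideanSpace ℝ (Fin 3)) (s : ℤ → ℤ) (z : ℤ → ℝ),
      IsHaggSeq s ∧ (∀ m : ℤ, 39 / 50 * a ≤ z (m + 1) - z m ∧ z (m + 1) - z m ≤ 17 / 20 * a) ∧
      (-(17 / 20 * a) ≤ z 0 ∧ z 0 ≤ 0) ∧
      let S : Set (EuclideanSpace ℝ (Fin 3)) :=
        {p | ∃ m i j : ℤ, p = A (((i : ℝ) • triangularVec₁ a) + ((j : ℝ) • triangularVec₂ a) +
          ((haggLabel s m : ℝ) • barlowOffset a) + (z m • layerNormal 1))};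
      (∀ p ∈ S, ‖p‖ ≤ k → ∃ i : Fin N, dist (x N i + t) p ≤ 1 / ((k : ℝ) + 1)) ∧
      (∀ i : Fin N, ‖x N i + t‖ ≤ k → ∃ p ∈ S, dist (x N i + t) p ≤ 1 / ((k : ℝ) + 1)) := by
    intro k
    refine (hW ((k : ℝ) + 2) (1 / ((k : ℝ) + 1)) (by positivity)).mono fun N hN => ?_
    obtain ⟨A, t, s, z, hs, hz, hM⟩ := hN
    obtain ⟨t', s', z', hs', hz', hz0', hM'⟩ := ext_normalise (x N) ha0 ha1 A t s z hs hz hM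
    exact ⟨A, t', s', z', hs', hz', hz0', hM'⟩
  obtain ⟨φ, hφ, hφW⟩ := extraction_forall_of_frequently h1
  choose A t s z hs hz hz0 hM using hφW
  -- Step 2: a cluster point of the data in the compact data space
  have hKc := ext_isCompact_isometries.prod (ext_isCompact_words.prod (ext_isCompact_heights a))
  have hdK : ∀ k, ((A k).toContinuousLinearMap, s k, z k) ∈
      {L : EuclideanSpace ℝ (Fin 3) →L[ℝ] EuclideanSpace ℝ (Fin 3) | ∀ v, ‖L v‖ = ‖v‖} ×ˢ
        ((Set.pi Set.univ fun _ : ℤ => ({1, -1} : Set ℤ)) ×ˢ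
        {z : ℤ → ℝ | (-(17 / 20 * a) ≤ z 0 ∧ z 0 ≤ 0) ∧
          ∀ m : ℤ, 39 / 50 * a ≤ z (m + 1) - z m ∧ z (m + 1) - z m ≤ 17 / 20 * a}) := fun k =>
    Set.mk_mem_prod (fun v => (A k).norm_map v) (Set.mk_mem_prod
      (Set.mem_univ_pi.2 fun i => by rcases hs k i with h | h <;> simp [h]) ⟨hz0 k, hz k⟩)
  obtain ⟨⟨L₀, s₀, z₀⟩, hmem, hcl⟩ := hKc.exists_mapClusterPt (f := atTop)
    (u := fun k => ((A k).toContinuousLinearMap, s k, z k))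
    (tendsto_principal.2 (Eventually.of_forall hdK))
  have hL₀ : ∀ v, ‖L₀ v‖ = ‖v‖ := hmem.1
  have hs₀ : IsHaggSeq s₀ := fun i => by simpa using Set.mem_univ_pi.1 hmem.2.1 i
  have hz₀ : (-(17 / 20 * a) ≤ z₀ 0 ∧ z₀ 0 ≤ 0) ∧
      ∀ m : ℤ, 39 / 50 * a ≤ z₀ (m + 1) - z₀ m ∧ z₀ (m + 1) - z₀ m ≤ 17 / 20 * a := hmem.2.2
  rw [mapClusterPt_iff_frequently] at hcl
  let A₀ : EuclideanSpace ℝ (Fin 3) →ₗᵢ[ℝ] EuclideanSpace ℝ (Fin 3) :=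
    ⟨(L₀ : EuclideanSpace ℝ (Fin 3) →ₗ[ℝ] EuclideanSpace ℝ (Fin 3)), hL₀⟩
  have hA₀ : ∀ v, A₀ v = L₀ v := fun v => rfl
  refine ⟨A₀, s₀, z₀, hs₀, hz₀.2, ?_⟩
  intro S R ε hε
  -- Step 3: parameters for the target scale `(R, ε)`
  obtain ⟨η, hη0, hηε, hη1⟩ : ∃ η : ℝ, 0 < η ∧ η ≤ ε ∧ η ≤ 1 :=
    ⟨min ε 1, lt_min hε one_pos, min_le_left _ _, min_le_right _ _⟩
  obtain ⟨R', hR'0, hRR'⟩ : ∃ R' : ℝ, 0 ≤ R' ∧ R ≤ R' :=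
    ⟨max R 0, le_max_right _ _, le_max_left _ _⟩
  obtain ⟨M, hMR⟩ : ∃ M : ℕ, R' + 2 ≤ 39 / 50 * a * M := by
    obtain ⟨M, hM⟩ := exists_nat_ge ((R' + 2) / (39 / 50 * a))
    exact ⟨M, by rwa [div_le_iff₀' (by positivity)] at hM⟩
  obtain ⟨k₀, hk₀R, hk₀η⟩ : ∃ k₀ : ℕ, R' + 1 ≤ k₀ ∧ 1 / ((k₀ : ℝ) + 1) ≤ η / 2 := by
    obtain ⟨k₀, hk₀⟩ := exists_nat_ge (max (R' + 1) (2 / η))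
    refine ⟨k₀, (le_max_left _ _).trans hk₀, ?_⟩
    have h2 : 2 / η ≤ k₀ := (le_max_right _ _).trans hk₀
    rw [div_le_iff₀ hη0] at h2
    rw [div_le_iff₀ (by positivity)]
    nlinarith
  have hκ0 : 0 < η / (4 * (R' + 2)) := by positivity
  -- Step 4: the neighbourhood of the cluster point adapted to `(R', η, M)`
  have hU : ∀ᶠ e in 𝓝 ((L₀, s₀, z₀) :
      (EuclideanSpace ℝ (Fin 3) →L[ℝ] EuclideanSpace ℝ (Fin 3)) × ((ℤ → ℤ) × (ℤ → ℝ))),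
      dist e.1 L₀ ≤ η / (4 * (R' + 2)) ∧ (∀ m ∈ Finset.Icc (-(M : ℤ)) M, e.2.1 m = s₀ m) ∧
        (∀ m ∈ Finset.Icc (-(M : ℤ)) M, dist (e.2.2 m) (z₀ m) ≤ η / 4) := by
    refine Eventually.and ?_ (Eventually.and ?_ ?_)
    · have h1 : ∀ᶠ y in 𝓝 L₀, dist y L₀ ≤ η / (4 * (R' + 2)) := Metric.closedBall_mem_nhds L₀ hκ0
      exact (continuous_fst.tendsto (L₀, s₀, z₀)).eventually h1
    · refine (eventually_all_finset _).2 fun m _ => ?_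
      have hc : Continuous fun e :
          (EuclideanSpace ℝ (Fin 3) →L[ℝ] EuclideanSpace ℝ (Fin 3)) × ((ℤ → ℤ) × (ℤ → ℝ)) =>
            e.2.1 m :=
        (continuous_apply m).comp (continuous_fst.comp continuous_snd)
      exact (hc.tendsto (L₀, s₀, z₀)).eventually
        (show ∀ᶠ y in 𝓝 (s₀ m), y = s₀ m by simp [nhds_discrete])
    · refine (eventually_all_finset _).2 fun m _ => ?_
      have hc : Continuous fun e :
          (EuclideanSpace ℝ (Fin 3) →L[ℝ] EuclideanSpace ℝ (Fin 3)) × ((ℤ → ℤ) × (ℤ → ℝ)) =>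
            e.2.2 m :=
        (continuous_apply m).comp (continuous_snd.comp continuous_snd)
      exact (hc.tendsto (L₀, s₀, z₀)).eventually
        (Metric.closedBall_mem_nhds (z₀ m) (by positivity : (0 : ℝ) < η / 4))
  have hfr := hcl _ hU
  -- Step 5: a window far out in the diagonal sequence whose data lie in the neighbourhood
  rw [frequently_atTop]
  intro Nmin
  have hev : ∀ᶠ k in atTop, k₀ ≤ k ∧ Nmin ≤ φ k :=
    (eventually_ge_atTop k₀).and (hφ.tendsto_atTop.eventually_ge_atTop Nmin)
  obtain ⟨k, hkU, hk₀, hkN⟩ := (hfr.and_eventually hev).exists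
  refine ⟨φ k, hkN, t k, ?_⟩
  simp only [Set.mem_setOf_eq] at hkU
  obtain ⟨hkA, hks, hkz⟩ := hkU
  -- closeness of the data
  have hss : ∀ m : ℤ, |m| ≤ M → s k m = s₀ m := fun m hm =>
    hks m (Finset.mem_Icc.2 (abs_le.1 hm))
  have hzz : ∀ m : ℤ, |m| ≤ M → |z k m - z₀ m| ≤ η / 4 := fun m hm => by
    rw [← Real.dist_eq]
    exact hkz m (Finset.mem_Icc.2 (abs_le.1 hm))
  have hAA : ∀ v : EuclideanSpace ℝ (Fin 3), ‖v‖ ≤ R' + 1 → ‖A k v - A₀ v‖ ≤ η / 4 := by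
    intro v hv
    rw [hA₀, show A k v - L₀ v = ((A k).toContinuousLinearMap - L₀) v from rfl]
    rw [dist_eq_norm] at hkA
    calc ‖((A k).toContinuousLinearMap - L₀) v‖ ≤ ‖(A k).toContinuousLinearMap - L₀‖ * ‖v‖ :=
          ContinuousLinearMap.le_opNorm _ _
      _ ≤ η / (4 * (R' + 2)) * (R' + 2) :=
          mul_le_mul hkA (by linarith) (norm_nonneg _) hκ0.le
      _ = η / 4 := by field_simp
  -- Step 6: transfer the match `S_k → S₀`
  have hmk := hM k
  dsimp only at hmk
  have hkR : R' + 1 ≤ (k : ℝ) := hk₀R.trans (by exact_mod_cast hk₀)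
  have hkη : 1 / ((k : ℝ) + 1) ≤ η / 2 := by
    refine le_trans (one_div_le_one_div_of_le (by positivity) ?_) hk₀η
    have : (k₀ : ℝ) ≤ k := by exact_mod_cast hk₀
    linarith
  have h2 := ext_match_mono (x (φ k)) (t k) _ hkR hkη hmk
  have h3 := ext_match_perturb (x (φ k)) (t k) _ S hη1
    (ext_close_points ha0 ha1 (A k) A₀ (s k) s₀ (z k) z₀ (hz k) (hz0 k) hMR hss hzz hAA)
    (ext_close_points ha0 ha1 A₀ (A k) s₀ (s k) z₀ (z k) hz₀.2 hz₀.1 hMR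
      (fun m hm => (hss m hm).symm) (fun m hm => by rw [abs_sub_comm]; exact hzz m hm)
      (fun v hv => by rw [norm_sub_rev]; exact hAA v hv)) h2
  exact ext_match_mono (x (φ k)) (t k) S hRR' hηε h3

end Summit.AtomisticToContinuum.Crystallization.Theorems.LayeredHull

end
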